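import Summits.QuantumFields.BalabanUV.T4Continuum.Support.NE7LoewnerDiagramBV

/-!
# NE7LoewnerDiagramVertices — row NE7 (node U5), route «PAIR-CAUCHY» ∕ supplier LÖW (ROUTES-NE7.md §L2.2 B3, LÖW-res (a)):
# DIAGRAMS WITH K-DEPENDENT VERTEX WEIGHTS along a Löwner chain, IN THE TWO CURRENCIES — the NULL currency of PAIR-CAUCHY
# needs only CONVERGENT vertices (no rate, no summability), the ℓ¹ currency of road P1 needs SUMMABLE vertex increments,
# and the gap between the two is real (a convergent vertex sequence whose diagram values are not of bounded variation)

Cell `pub-balaban`, rung (B)+1 sub-cell t4, lineage `b2b-balaban-t4-ne7-p2` (CRUX PROVER NE7 #2 under the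
coordinator ruling «YM redirect», 2026-08-21; generation 54; texts: the crux refuter's `HOME/b2b-balaban-t4-ne7-refuter/
PRICING-NE7.md` v9 §49 F33 «`summable_norm_diagram_plaqCov_sub` is LITERALLY NE7's «Σ_K δ_K < ∞» for the class 𝒟₀ :=
{finite Feynman diagrams whose LINES are entries of that plaquette block and whose VERTEX WEIGHTS w are K-INDEPENDENT} …
What is NOT in 𝒟₀ = LÖW-res … (a) K-DEPENDENT vertices — … ‖F_K − F_{K+1}‖ ≤ ‖diagram(w_K − w_{K+1}; C_K)‖ + [LÖW term],
and the first summand needs Σ_K‖w_K − w_{K+1}‖₁ < ∞ — a RATE∕ℓ¹ datum on the vertices, i.e. R-P1∕R-P2's currency re-enters»,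
and `HOME/t4/b2b-balaban-t4-ne7-p2/g54/ROUTE2-NE7-P2.md` v1.9 §12.  HONEST FRAMING (page 1): FIXED FINITE T⁴, rung (B)+1 =
existence AND uniqueness of the `ε = L^{−K} → 0` limit of unit-scale averaged expectations, CONDITIONAL on BetaPertH and
the nine spine estimates (0/9 proved); NOT infinite volume, NOT a mass gap, NOT the Clay problem.  NE7 is NOT PRINTED in
[Balaban1984PropagatorsI]–[Balaban1989LargeFieldII] and NOT proved here.  Everything below is [folklore] finite-dimensional
linear algebra and real analysis over HYPOTHESIS SHAPES (an abstract Löwner chain of complex matrices and an abstract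
sequence of vertex weights); no definition, no cite tag, nothing printed asserted, no `sorry`.

WHY.  F33 prices LÖW-res (a) in ONE currency: for diagrams `F_K = diagram(w_K; C_K)` whose vertex weights depend on the
step, the ℓ¹ statement `Σ_K ‖F_K − F_{K+1}‖ < ∞` needs `Σ_K ‖w_K − w_{K+1}‖₁ < ∞` besides B3.  Route PAIR-CAUCHY consumes
the NULL currency only (`NE7PairwiseScaleShift.nullShift_of_split`'s binder `hconv : ∀ k ≤ j, |b j − b_∞| ≤ c₀ k`,
`c₀ → 0`; ROUTE2 §2 T.5♭), and there LÖW-res (a) is cheaper: `diagram` is LINEAR in the weight with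
`‖diagram(w; C)‖ ≤ γ^{|E|}·‖w‖₁` under a uniform entry bound `γ` (§1), so along a Löwner chain
  `‖diagram(w_K; P_K) − diagram(w_∞; P_K)‖ ≤ (re tr P k₀)^{|E|}·‖w_K − w_∞‖₁ → 0`
whenever the vertices merely CONVERGE, and `diagram(w_∞; P_K)` converges by B3 (`NE7LoewnerDiagramBV.exists_tendsto_diagram`);
hence `F_K` converges and has a null tail modulus — NO rate and NO summability asked of the vertices (§3).  In the ℓ¹
currency the vertex increments must be summable, and then they suffice (§4, the F33 sentence as a theorem).  The gap is
real (§5): the weights `w_K = (−1)^K∕(K+1)` converge, yet along a constant chain the diagram values have increments of norm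
`1∕(K+1) + 1∕(K+2)` — not summable (harmonic series).  So at LÖW-res (a) the null currency is STRICTLY cheaper than ℓ¹:
a located instance of ROUTE2 §3 «5 geometric two-run rates → null moduli» on the supplier side, recorded against the
refuter's standing caveat (PRICING v2 §9.4 (b)(iii) «in practice null will be delivered THROUGH a rate»): here it is not.

WHAT IS PROVED ([folklore]; `diagram` = `NE7LoewnerDiagramBV.diagram`; chain binders `hstep`, `hpos` from `k₀` as there).
§1 WEIGHTS: `diagram_sub_weights` (linearity in `w`), `norm_diagram_le` (`‖diagram(w; C)‖ ≤ γ^{|E|}·Σ_x ‖w x‖` under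
   `‖C a b‖ ≤ γ`), `norm_diagram_sub_weights_le`; `norm_diagram_sub_le_split` (vertices AND lines move: two-term split).
§2 A GENERIC TAIL LEMMA: `nullTail_of_tendsto` (every convergent real sequence has a null tail modulus
   `∃ c, (∀ k ≤ j, |a j − L| ≤ c k) ∧ c → 0` — the `hconv` shape; complements `NE7PairwiseMonotone.nullTail_of_summable_increments`
   ∕ `nullTail_of_monotone_bddAbove`, which reach the same shape from ℓ¹ ∕ monotone data).
§3 NULL CURRENCY: `tendsto_sum_norm_weights_sub` (pointwise convergent weights on a finite vertex-position type ⟹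
   `‖w_K − w_∞‖₁ → 0`), **`tendsto_diagram_of_tendsto_weights`** (convergent vertices + Löwner chain ⟹ `diagram(w_K; P(K+k₀))`
   converges), **`nullTail_re_diagram_of_tendsto_weights`** (its real part has the `hconv` null tail modulus, no rate).
§4 ℓ¹ CURRENCY: **`summable_norm_diagram_sub_of_summable_weights`** (bounded weights with summable increments + Löwner
   chain ⟹ summable diagram increments — F33's sentence for LÖW-res (a)).
§5 CONTRAST: `norm_altWeight_sub` (the increments of `(−1)^K∕(K+1)` have norm `1∕(K+2) + 1∕(K+1)`),
   **`exists_tendsto_weights_not_bv`** (convergent vertex weights whose diagram values along a constant — hence Löwner —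
   chain are NOT of bounded variation: null currency available, ℓ¹ currency not).

HONEST LIMITS.  (i) Whether Bałaban's step-K effective vertices converge, or have summable increments, is the RG content
((CONV-C) ∕ G-an2-4 type) — a HYPOTHESIS SHAPE here, discharged for nothing; (ii) LÖW-res (b) fine-scale lines, (d)
gauge-variant blocks, (e) ghost lines (PRICING v9 §49) are untouched — only (a) is addressed, and only as bookkeeping over an
abstract chain; (iii) constants are the trace form of B3 (the intensive form of `NE7LoewnerDiagramBVIntensive` would serve
equally; convergence statements display no constant).  NOT NE7 (spine 0/9 unchanged), NOT BetaPertH, NOT summit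
progress.  HONEST DEPENDENCY: continuum YM on T⁴ ⇐ BetaPertH ∧ nine spine estimates (0/9 proved); BetaPertH ⇐ (D1) ∧ (D4)
∧ CAP+tail; G-an2-4 gates asym, D1 and NE2/3/4.
-/

noncomputable section

open Finset Filter Topology
open scoped BigOperators ComplexOrder

namespace Summit.QuantumFields.BalabanUV.T4Continuum.NE7LoewnerDiagramVertices

open Summit.QuantumFields.BalabanUV.T4Continuum.NE7LoewnerDiagramBV
  (diagram norm_prod_le_pow_card norm_diagram_sub_le re_trace_head_nonneg norm_apply_le_re_trace_head
    sum_norm_apply_sub_succ_le' re_diag_le_re_trace_head summable_norm_apply_sub_succ exists_tendsto_diagram)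

/-! ## §1 The diagram as a function of its vertex weight -/

section Weights

variable {ε ι n : Type*} [Fintype ε] [Fintype ι] [DecidableEq ι] [Fintype n]

/-- LINEARITY IN THE WEIGHT: `diagram(w; C) − diagram(w′; C) = diagram(w − w′; C)`. [folklore] -/
theorem diagram_sub_weights (src tgt : ε → ι) (w w' : (ι → n) → ℂ) (C : Matrix n n ℂ) :
    diagram src tgt w C - diagram src tgt w' C = diagram src tgt (fun x => w x - w' x) C := by
  unfold diagram
  rw [← sum_sub_distrib]
  refine sum_congr rfl fun x _ => ?_
  ring

/-- SIZE: under a uniform entry bound `‖C a b‖ ≤ γ`, `‖diagram(w; C)‖ ≤ γ^{|E|}·Σ_x ‖w x‖`. [folklore] -/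
theorem norm_diagram_le (src tgt : ε → ι) (w : (ι → n) → ℂ) {C : Matrix n n ℂ} {γ : ℝ}
    (hC : ∀ a b, ‖C a b‖ ≤ γ) : ‖diagram src tgt w C‖ ≤ γ ^ Fintype.card ε * ∑ x : ι → n, ‖w x‖ := by
  unfold diagram
  rw [mul_sum]
  refine (norm_sum_le _ _).trans (sum_le_sum fun x _ => ?_)
  rw [norm_mul]
  have h := norm_prod_le_pow_card (univ : Finset ε) (a := fun e => C (x (src e)) (x (tgt e))) fun e _ => hC _ _
  rw [card_univ] at h
  calc ‖w x‖ * ‖∏ e, C (x (src e)) (x (tgt e))‖ ≤ ‖w x‖ * γ ^ Fintype.card ε :=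
        mul_le_mul_of_nonneg_left h (norm_nonneg _)
    _ = γ ^ Fintype.card ε * ‖w x‖ := mul_comm _ _

/-- … hence `‖diagram(w; C) − diagram(w′; C)‖ ≤ γ^{|E|}·Σ_x ‖w x − w′ x‖`. [folklore] -/
theorem norm_diagram_sub_weights_le (src tgt : ε → ι) (w w' : (ι → n) → ℂ) {C : Matrix n n ℂ} {γ : ℝ}
    (hC : ∀ a b, ‖C a b‖ ≤ γ) :
    ‖diagram src tgt w C - diagram src tgt w' C‖ ≤ γ ^ Fintype.card ε * ∑ x : ι → n, ‖w x - w' x‖ := by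
  rw [diagram_sub_weights]
  exact norm_diagram_le src tgt _ hC

/-- TWO-TERM SPLIT when vertices AND lines move: under uniform entry bounds `γ` on `C`,
`‖diagram(w; C) − diagram(w′; C′)‖ ≤ γ^{|E|}·‖w − w′‖₁ + ‖diagram(w′; C) − diagram(w′; C′)‖`. [folklore] -/
theorem norm_diagram_sub_le_split (src tgt : ε → ι) (w w' : (ι → n) → ℂ) {C C' : Matrix n n ℂ} {γ : ℝ}
    (hC : ∀ a b, ‖C a b‖ ≤ γ) :
    ‖diagram src tgt w C - diagram src tgt w' C'‖ ≤
      γ ^ Fintype.card ε * ∑ x : ι → n, ‖w x - w' x‖ + ‖diagram src tgt w' C - diagram src tgt w' C'‖ := by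
  have e : diagram src tgt w C - diagram src tgt w' C' =
      (diagram src tgt w C - diagram src tgt w' C) + (diagram src tgt w' C - diagram src tgt w' C') := by abel
  rw [e]
  exact (norm_add_le _ _).trans (add_le_add (norm_diagram_sub_weights_le src tgt w w' hC) le_rfl)

end Weights

/-! ## §2 A generic tail lemma: every convergent real sequence has a null tail modulus -/

/-- **CONVERGENT ⟹ NULL TAIL MODULUS** (the `hconv` shape of `NE7PairwiseScaleShift.nullShift_of_split`): if `a → L` then
`c k := sup_{j ≥ k} |a j − L|` satisfies `|a j − L| ≤ c k` for `j ≥ k` and `c k → 0`. [folklore] -/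
theorem nullTail_of_tendsto {a : ℕ → ℝ} {L : ℝ} (h : Tendsto a atTop (𝓝 L)) :
    ∃ c : ℕ → ℝ, (∀ k j, k ≤ j → |a j - L| ≤ c k) ∧ Tendsto c atTop (𝓝 0) := by
  -- the deviations `e j := |a j − L|` tend to `0`, hence are bounded
  have he : Tendsto (fun j => |a j - L|) atTop (𝓝 0) := by
    have h1 : Tendsto (fun j => a j - L) atTop (𝓝 0) := by simpa using h.sub_const L
    simpa using h1.abs
  have hbdd : BddAbove (Set.range fun j => |a j - L|) := he.bddAbove_range
  -- shifted suprema
  have hbddk : ∀ k, BddAbove (Set.range fun i : ℕ => |a (i + k) - L|) := by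
    intro k
    obtain ⟨B, hB⟩ := hbdd
    exact ⟨B, by rintro _ ⟨i, rfl⟩; exact hB ⟨i + k, rfl⟩⟩
  refine ⟨fun k => ⨆ i : ℕ, |a (i + k) - L|, fun k j hkj => ?_, ?_⟩
  · obtain ⟨i, rfl⟩ := Nat.exists_eq_add_of_le' hkj
    exact le_ciSup (hbddk k) i
  · refine Metric.tendsto_atTop.2 fun δ hδ => ?_
    obtain ⟨K, hK⟩ := Metric.tendsto_atTop.1 he (δ / 2) (by linarith)
    refine ⟨K, fun k hk => ?_⟩
    have hle : (⨆ i : ℕ, |a (i + k) - L|) ≤ δ / 2 := by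
      refine ciSup_le fun i => ?_
      have h' := hK (i + k) (hk.trans (Nat.le_add_left k i))
      rw [Real.dist_eq, sub_zero, abs_abs] at h'
      exact h'.le
    have hge : 0 ≤ ⨆ i : ℕ, |a (i + k) - L| := (abs_nonneg _).trans (le_ciSup (hbddk k) 0)
    rw [Real.dist_eq, sub_zero, abs_of_nonneg hge]
    linarith

/-! ## §3 NULL CURRENCY: convergent vertices suffice -/

section Null

variable {ε ι n : Type*} [Fintype ε] [DecidableEq ε] [Fintype ι] [DecidableEq ι] [Fintype n]

/-- Pointwise convergent weights on the finite vertex-position type converge in `ℓ¹`: `Σ_x ‖w_K x − w_∞ x‖ → 0`. [folklore] -/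
theorem tendsto_sum_norm_weights_sub {w : ℕ → (ι → n) → ℂ} {winf : (ι → n) → ℂ}
    (hw : ∀ x, Tendsto (fun K => w K x) atTop (𝓝 (winf x))) :
    Tendsto (fun K => ∑ x : ι → n, ‖w K x - winf x‖) atTop (𝓝 0) := by
  have h : Tendsto (fun K => ∑ x : ι → n, ‖w K x - winf x‖) atTop (𝓝 (∑ _x : ι → n, (0 : ℝ))) := by
    refine tendsto_finsetSum _ fun x _ => ?_
    have h1 : Tendsto (fun K => w K x - winf x) atTop (𝓝 0) := by simpa using (hw x).sub_const (winf x)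
    simpa using h1.norm
  simpa using h

variable {P : ℕ → Matrix n n ℂ} {k₀ : ℕ}

/-- **CONVERGENT VERTICES ⟹ CONVERGENT DIAGRAMS ALONG A LÖWNER CHAIN — NO RATE, NO SUMMABILITY.**  PSD steps and members from
`k₀`, and vertex weights `w_K → w_∞` pointwise ⟹ `K ↦ diagram(w_K; P(K+k₀))` converges (to B3's limit of
`diagram(w_∞; P(K+k₀))`). [folklore] -/
theorem tendsto_diagram_of_tendsto_weights (hstep : ∀ j, k₀ ≤ j → (P j - P (j + 1)).PosSemidef)
    (hpos : ∀ j, k₀ ≤ j → (P j).PosSemidef) (src tgt : ε → ι) {w : ℕ → (ι → n) → ℂ} {winf : (ι → n) → ℂ}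
    (hw : ∀ x, Tendsto (fun K => w K x) atTop (𝓝 (winf x))) :
    ∃ Finf : ℂ, Tendsto (fun K => diagram src tgt (w K) (P (K + k₀))) atTop (𝓝 Finf) := by
  obtain ⟨Finf, hF⟩ := exists_tendsto_diagram hstep hpos src tgt winf
  refine ⟨Finf, ?_⟩
  set γ : ℝ := (P k₀).trace.re
  -- the vertex part tends to zero
  have hdiff : Tendsto (fun K => diagram src tgt (w K) (P (K + k₀)) - diagram src tgt winf (P (K + k₀))) atTop (𝓝 0) := by
    refine squeeze_zero_norm (fun K => norm_diagram_sub_weights_le src tgt (w K) winf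
      (fun a b => norm_apply_le_re_trace_head hstep hpos (Nat.le_add_left k₀ K) a b)) ?_
    simpa using (tendsto_sum_norm_weights_sub hw).const_mul (γ ^ Fintype.card ε)
  have h := hdiff.add hF
  simpa using h

/-- **NULL TAIL MODULUS, NO RATE, FOR A DIAGRAM WITH CONVERGENT K-DEPENDENT VERTICES** — LÖW-res (a) in the NULL currency:
`∃ F_∞ c₀, (∀ k ≤ j, |re diagram(w_j; P(j+k₀)) − F_∞| ≤ c₀ k) ∧ c₀ → 0`, the `hconv` binder shape of
`NE7PairwiseScaleShift.nullShift_of_split`, from convergent vertices and the Löwner chain alone. [folklore] -/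
theorem nullTail_re_diagram_of_tendsto_weights (hstep : ∀ j, k₀ ≤ j → (P j - P (j + 1)).PosSemidef)
    (hpos : ∀ j, k₀ ≤ j → (P j).PosSemidef) (src tgt : ε → ι) {w : ℕ → (ι → n) → ℂ} {winf : (ι → n) → ℂ}
    (hw : ∀ x, Tendsto (fun K => w K x) atTop (𝓝 (winf x))) :
    ∃ Finf : ℝ, ∃ c₀ : ℕ → ℝ,
      (∀ k j, k ≤ j → |(diagram src tgt (w j) (P (j + k₀))).re - Finf| ≤ c₀ k) ∧ Tendsto c₀ atTop (𝓝 0) := by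
  obtain ⟨Finf, hF⟩ := tendsto_diagram_of_tendsto_weights hstep hpos src tgt hw
  have hre : Tendsto (fun K => (diagram src tgt (w K) (P (K + k₀))).re) atTop (𝓝 Finf.re) :=
    (Complex.continuous_re.tendsto Finf).comp hF
  obtain ⟨c, hc, hc0⟩ := nullTail_of_tendsto hre
  exact ⟨Finf.re, c, hc, hc0⟩

end Null

/-! ## §4 ℓ¹ CURRENCY: summable vertex increments suffice (F33's sentence for LÖW-res (a)) -/

section L1

variable {ε ι n : Type*} [Fintype ε] [DecidableEq ε] [Fintype ι] [DecidableEq ι] [Fintype n]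
variable {P : ℕ → Matrix n n ℂ} {k₀ : ℕ}

/-- **BOUNDED WEIGHTS WITH SUMMABLE INCREMENTS ⟹ SUMMABLE DIAGRAM INCREMENTS ALONG A LÖWNER CHAIN** (`K + k₀ + 1 = (K+1) + k₀`):
`Σ_K ‖diagram(w_{K+1}; P(K+k₀+1)) − diagram(w_K; P(K+k₀))‖ < ∞` from `‖w_K x‖ ≤ W`, `Σ_K ‖w_{K+1} x − w_K x‖ < ∞` for each
vertex position `x`, and B3's per-entry summability. [folklore] -/
theorem summable_norm_diagram_sub_of_summable_weights (hstep : ∀ j, k₀ ≤ j → (P j - P (j + 1)).PosSemidef)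
    (hpos : ∀ j, k₀ ≤ j → (P j).PosSemidef) (src tgt : ε → ι) {w : ℕ → (ι → n) → ℂ} {W : ℝ}
    (hW : ∀ K x, ‖w K x‖ ≤ W) (hw : ∀ x, Summable fun K => ‖w (K + 1) x - w K x‖) :
    Summable fun K => ‖diagram src tgt (w (K + 1)) (P (K + k₀ + 1)) - diagram src tgt (w K) (P (K + k₀))‖ := by
  set γ : ℝ := (P k₀).trace.re with hγ_def
  have hγ : 0 ≤ γ := re_trace_head_nonneg hpos
  -- entry bounds along the chain
  have hent : ∀ K a b, ‖P (K + k₀) a b‖ ≤ γ := fun K a b =>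
    norm_apply_le_re_trace_head hstep hpos (Nat.le_add_left k₀ K) a b
  have hent' : ∀ K a b, ‖P (K + k₀ + 1) a b‖ ≤ γ := fun K a b =>
    norm_apply_le_re_trace_head hstep hpos ((Nat.le_add_left k₀ K).trans (Nat.le_succ _)) a b
  -- the majorant: vertex part + line part
  set A : ℕ → ℝ := fun K => γ ^ Fintype.card ε * ∑ x : ι → n, ‖w (K + 1) x - w K x‖
  set B : ℕ → ℝ := fun K => γ ^ (Fintype.card ε - 1) * ∑ x : ι → n, W *
    ∑ e, ‖P (K + k₀) (x (src e)) (x (tgt e)) - P (K + k₀ + 1) (x (src e)) (x (tgt e))‖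
  have hA : Summable A := (summable_sum fun x _ => hw x).mul_left _
  have hB : Summable B := by
    refine (summable_sum fun x _ => (summable_sum fun e _ => ?_).mul_left W).mul_left _
    exact summable_norm_apply_sub_succ hstep hpos (x (src e)) (x (tgt e))
  refine (hA.add hB).of_nonneg_of_le (fun _ => norm_nonneg _) fun K => ?_
  -- split: move the vertices at fixed lines `P(K+k₀+1)`, then the lines at fixed vertices `w K`
  have hsplit := norm_diagram_sub_le_split src tgt (w (K + 1)) (w K) (C := P (K + k₀ + 1)) (C' := P (K + k₀))
    (hent' K)
  have hline : ‖diagram src tgt (w K) (P (K + k₀ + 1)) - diagram src tgt (w K) (P (K + k₀))‖ ≤ B K := by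
    rw [norm_sub_rev]
    refine (norm_diagram_sub_le src tgt (w K) hγ (hent K) (hent' K)).trans ?_
    refine mul_le_mul_of_nonneg_left (sum_le_sum fun x _ => ?_) (pow_nonneg hγ _)
    exact mul_le_mul_of_nonneg_right (hW K x) (sum_nonneg fun _ _ => norm_nonneg _)
  exact hsplit.trans (add_le_add le_rfl hline)

end L1

/-! ## §5 CONTRAST: convergent vertices whose diagram values are not of bounded variation -/

section Contrast

/-- The increments of the alternating weights `(−1)^K∕(K+1)` have norm `1∕(K+2) + 1∕(K+1)`. [folklore] -/
theorem norm_altWeight_sub (K : ℕ) :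
    ‖((-1 : ℂ) ^ (K + 1) / ((K : ℂ) + 2) - (-1 : ℂ) ^ K / ((K : ℂ) + 1))‖ =
      1 / ((K : ℝ) + 2) + 1 / ((K : ℝ) + 1) := by
  have e : (-1 : ℂ) ^ (K + 1) / ((K : ℂ) + 2) - (-1 : ℂ) ^ K / ((K : ℂ) + 1) =
      (-1 : ℂ) ^ (K + 1) * (((1 / ((K : ℝ) + 2) + 1 / ((K : ℝ) + 1) : ℝ) : ℂ)) := by
    push_cast
    ring
  rw [e, norm_mul, norm_pow, norm_neg, norm_one, one_pow, one_mul, Complex.norm_real, Real.norm_eq_abs,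
    abs_of_pos (by positivity)]

/-- **THE GAP IS REAL.**  With NO edges and ONE vertex position (`ε = Empty`, `ι = n = Unit`; any 1×1 kernel `C`, a constant —
hence Löwner — chain) the diagram value is the weight itself; the weights `w_K ≡ (−1)^K∕(K+1)` CONVERGE (to `0`, so §3 gives
the null tail for free) but the diagram increments have norm `1∕(K+2) + 1∕(K+1)`, NOT summable (harmonic series): the ℓ¹
currency is unavailable while the null currency holds. [folklore] -/
theorem exists_tendsto_weights_not_bv (C : Matrix Unit Unit ℂ) :
    ∃ w : ℕ → (Unit → Unit) → ℂ, (∀ x, Tendsto (fun K => w K x) atTop (𝓝 0)) ∧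
      ¬ Summable fun K => ‖diagram (ε := Empty) Empty.elim Empty.elim (w (K + 1)) C -
        diagram (ε := Empty) Empty.elim Empty.elim (w K) C‖ := by
  refine ⟨fun K _ => (-1 : ℂ) ^ K / ((K : ℂ) + 1), fun _ => ?_, fun hs => ?_⟩
  · -- `‖(−1)^K∕(K+1)‖ = 1∕(K+1) → 0`
    refine squeeze_zero_norm (fun K => ?_) tendsto_one_div_add_atTop_nhds_zero_nat
    rw [norm_div, norm_pow, norm_neg, norm_one, one_pow]
    have hK : ‖((K : ℂ) + 1)‖ = (K : ℝ) + 1 := by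
      rw [show ((K : ℂ) + 1) = (((K : ℝ) + 1 : ℝ) : ℂ) by push_cast; ring, Complex.norm_real, Real.norm_eq_abs,
        abs_of_pos (by positivity)]
    rw [hK]
  · -- the diagram value is the weight; its increments are the alternating increments
    have hval : ∀ K : ℕ, diagram (ε := Empty) Empty.elim Empty.elim (fun _ : Unit → Unit => (-1 : ℂ) ^ K / ((K : ℂ) + 1)) C
        = (-1 : ℂ) ^ K / ((K : ℂ) + 1) := by
      intro K
      unfold diagram
      simp
    have hs' : Summable fun K : ℕ => 1 / ((K : ℝ) + 2) + 1 / ((K : ℝ) + 1) := by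
      refine hs.congr fun K => ?_
      dsimp only
      rw [hval (K + 1), hval K, show ((K + 1 : ℕ) : ℂ) + 1 = (K : ℂ) + 2 by push_cast; ring]
      exact norm_altWeight_sub K
    have hharm : Summable fun K : ℕ => 1 / ((K : ℝ) + 1) :=
      hs'.of_nonneg_of_le (fun K => by positivity) fun K => le_add_of_nonneg_left (by positivity)
    exact (not_summable_iff_tendsto_nat_atTop_of_nonneg (fun K => by positivity)).2
      Real.tendsto_sum_range_one_div_nat_succ_atTop hharm

end Contrast

end Summit.QuantumFields.BalabanUV.T4Continuum.NE7LoewnerDiagramVertices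

end
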